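import Mathlib
import Literature.NumberTheory.GaloisRepresentations.CyclicNormIndex
import HarnessLib

/-!
# Invariant ideals are principal (Chevalley's ambiguous-ideal count, cyclic cubic case)

Let `L/F` be a cyclic cubic extension of number fields with group `⟨σ⟩`, `𝓞_F` a PID, and let
`𝔓₁ ≠ 𝔓₂` be maximal ideals of `𝓞_L` with `𝔓ᵢ³ = (tᵢ)`, `tᵢ ∈ 𝓞_F`, such that every prime of
`L` ramified over `F` is `𝔓₁` or `𝔓₂`.  Suppose there are nine norm-one units `ε₀, …, ε₈` of `L`,
pairwise inequivalent modulo `σ`-coboundaries of units (`εᵢ η ≠ εⱼ σ(η)` for all units `η`,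
`i ≠ j`).  Then every nonzero `σ`-invariant ideal of `𝓞_L` is principal.

Proof.  (1) A nonzero `σ`-invariant ideal is `(c) · 𝔓₁^a · 𝔓₂^b` with `c ∈ 𝓞_F`, `a, b < 3`:
peel off, one at a time, either `𝔓ᵢ` (itself invariant since `𝔓ᵢ³ = (tᵢ)`) or, for an
unramified prime `𝔔 ⊇ I` over `𝔮`, the whole of `𝔮𝓞_L = ∏_{𝔔' ∣ 𝔮} 𝔔'` (the Galois group
`⟨σ⟩` is transitive on the primes over `𝔮` and fixes `I`, so every `𝔔' ∣ 𝔮` divides `I`), which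
is principal because `𝓞_F` is a PID; Noetherian induction.  (2) By Hilbert 90 each `εᵢ = σ(yᵢ)/yᵢ`
with `0 ≠ yᵢ ∈ 𝓞_L`, so `(yᵢ)` is invariant, `(yᵢ) = (cᵢ) 𝔓₁^{aᵢ} 𝔓₂^{bᵢ}`.  (3) The map
`i ↦ (aᵢ, bᵢ) ∈ (ℤ/3)²` is injective (a coincidence gives `yᵢ cⱼ = η yⱼ cᵢ` for a unit `η`, and
applying `σ`: `εⱼ η = εᵢ σ(η)`), hence surjective; the values `(1,0)` and `(0,1)` show that
`𝔓₁` and `𝔓₂` are principal.  (4) Hence so is every `(c) 𝔓₁^a 𝔓₂^b`.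
-/

set_option linter.dupNamespace false

noncomputable section

open NumberField Ideal

open scoped Pointwise NumberField

namespace Summit.QuantumAdvantage.QuantumAdvantage.Theorems.LinnikCubicClassGroups

open Literature.NumberTheory.GaloisRepresentations

variable {F L : Type*} [Field F] [Field L] [Algebra F L]

/-- An `F`-automorphism of `L` fixes the elements of `𝓞_L` coming from `𝓞_F`. [folklore] -/
theorem smul_algebraMap_ringOfIntegers (σ : L ≃ₐ[F] L) (t : 𝓞 F) :
    σ • algebraMap (𝓞 F) (𝓞 L) t = algebraMap (𝓞 F) (𝓞 L) t :=
  RingOfIntegers.ext (σ.commutes (t : F))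

/-- An `F`-automorphism of `L` fixes the principal ideal of `𝓞_L` generated by an element of
`𝓞_F`. [folklore] -/
theorem smul_span_algebraMap (σ : L ≃ₐ[F] L) (t : 𝓞 F) :
    σ • Ideal.span {algebraMap (𝓞 F) (𝓞 L) t} = Ideal.span {algebraMap (𝓞 F) (𝓞 L) t} := by
  rw [Ideal.smul_closure, Set.smul_set_singleton, smul_algebraMap_ringOfIntegers]

/-- A maximal ideal of `𝓞_L` whose cube is generated by an element of `𝓞_F` is invariant under
every `F`-automorphism. [folklore] -/
theorem smul_eq_of_pow_three_eq_span (σ : L ≃ₐ[F] L) {P : Ideal (𝓞 L)} (hP : P.IsMaximal)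
    {t : 𝓞 F} (ht : Ideal.span {algebraMap (𝓞 F) (𝓞 L) t} = P ^ 3) : σ • P = P := by
  have h3 : (σ • P) ^ 3 = P ^ 3 := by
    rw [← smul_pow', ← ht, smul_span_algebraMap]
  have hle : P ^ 3 ≤ σ • P := by
    rw [← h3]
    exact Ideal.pow_le_self three_ne_zero
  haveI : (σ • P).IsPrime := hP.isPrime.smul σ
  exact (hP.eq_of_le (IsPrime.ne_top inferInstance) (Ideal.IsPrime.le_of_pow_le hle)).symm

variable [NumberField L]

/-- Peeling an invariant proper factor `M ⊇ I` off a nonzero invariant ideal `I` leaves a strictly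
larger nonzero invariant ideal. [folklore] -/
theorem exists_eq_mul_of_le (σ : L ≃ₐ[F] L) {I M : Ideal (𝓞 L)} (hI : I ≠ ⊥) (hM : M ≠ ⊤)
    (hMinv : σ • M = M) (hinv : σ • I = I) (hle : I ≤ M) :
    ∃ J : Ideal (𝓞 L), I = M * J ∧ I < J ∧ J ≠ ⊥ ∧ σ • J = J := by
  obtain ⟨J, rfl⟩ := Ideal.dvd_iff_le.mpr hle
  have hM0 : M ≠ ⊥ := fun h => hI (by rw [h, Ideal.bot_mul])
  have hJ0 : J ≠ ⊥ := fun h => hI (by rw [h, Ideal.mul_bot])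
  refine ⟨J, rfl, ?_, hJ0, ?_⟩
  · refine lt_of_le_of_ne Ideal.mul_le_left (fun h => hM ?_)
    have : M * J = ⊤ * J := by rw [h, Ideal.top_mul]
    exact mul_right_cancel₀ hJ0 this
  · have h := hinv
    rw [smul_mul', hMinv] at h
    exact mul_left_cancel₀ hM0 h

variable [NumberField F]

/-- **One Galois orbit of unramified primes.**  If `I ≠ 0` is invariant under a generator `σ` of
`Gal(L/F)` and `I ≤ 𝔔` for a prime `𝔔` of `𝓞_L` unramified over `𝔮 = 𝔔 ∩ 𝓞_F`, then
`I ≤ 𝔮𝓞_L = ∏_{𝔔' ∣ 𝔮} 𝔔'` (transitivity of the Galois group on the primes over `𝔮`).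
[folklore] -/
theorem le_map_under_of_smul_eq [IsGalois F L] (σ : L ≃ₐ[F] L)
    (hσ : ∀ τ : L ≃ₐ[F] L, τ ∈ Subgroup.zpowers σ) {I Q : Ideal (𝓞 L)} (hI : I ≠ ⊥)
    (hQ : Q.IsMaximal) (he : Q.ramificationIdx (𝓞 F) = 1) (hinv : σ • I = I) (hIQ : I ≤ Q) :
    I ≤ (Q.under (𝓞 F)).map (algebraMap (𝓞 F) (𝓞 L)) := by
  classical
  haveI : (Q.under (𝓞 F)).IsMaximal := Ideal.IsMaximal.under (𝓞 F) Q
  haveI := hQ.isPrime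
  have hQ0 : Q ≠ ⊥ := fun h => hI (le_bot_iff.mp (h ▸ hIQ))
  have hq0 : Q.under (𝓞 F) ≠ ⊥ := mt Ideal.eq_bot_of_comap_eq_bot hQ0
  haveI hQq : Q.LiesOver (Q.under (𝓞 F)) := ⟨rfl⟩
  -- every element of the Galois group fixes `I`
  have hτI : ∀ τ : L ≃ₐ[F] L, τ • I = I := fun τ =>
    MulAction.mem_stabilizer_iff.mp
      ((Subgroup.zpowers_le.mpr (MulAction.mem_stabilizer_iff.mpr hinv)) (hσ τ))
  rw [Ideal.map_algebraMap_eq_finsetProd_pow (R := 𝓞 L) hq0, ← Ideal.dvd_iff_le]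
  refine Finset.prod_dvd_of_coprime ?_ ?_
  · intro Q₁ hQ₁ Q₂ hQ₂ hne
    rw [Finset.mem_coe, Set.mem_toFinset] at hQ₁ hQ₂
    haveI h1 : Q₁.IsMaximal := hQ₁.1.isMaximal (ne_bot_of_mem_primesOver hq0 hQ₁)
    haveI h2 : Q₂.IsMaximal := hQ₂.1.isMaximal (ne_bot_of_mem_primesOver hq0 hQ₂)
    exact (Ideal.isCoprime_of_isMaximal hne).pow
  · intro Q' hQ'
    rw [Set.mem_toFinset] at hQ'
    haveI := hQ'.1
    haveI := hQ'.2
    obtain ⟨τ, rfl⟩ := Ideal.exists_smul_eq_of_isGaloisGroup (Q.under (𝓞 F)) Q Q' (L ≃ₐ[F] L)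
    rw [Ideal.ramificationIdx_smul, he, pow_one, Ideal.dvd_iff_le, ← hτI τ]
    exact smul_mono_right τ hIQ

/-- **Structure of invariant ideals.**  With `𝓞_F` a PID, `𝔓ᵢ³ = (tᵢ)` (`tᵢ ∈ 𝓞_F`) and all
ramification carried by `𝔓₁, 𝔓₂`, a nonzero ideal of `𝓞_L` invariant under a generator `σ` of
`Gal(L/F)` is `(c) · 𝔓₁^a · 𝔓₂^b` with `c ∈ 𝓞_F` and `a, b < 3`. [folklore] -/
theorem exists_eq_span_mul_pow [IsGalois F L] (σ : L ≃ₐ[F] L)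
    (hσ : ∀ τ : L ≃ₐ[F] L, τ ∈ Subgroup.zpowers σ) (hPID : IsPrincipalIdealRing (𝓞 F))
    {P₁ P₂ : Ideal (𝓞 L)} (hP₁ : P₁.IsMaximal) (hP₂ : P₂.IsMaximal)
    {t₁ : 𝓞 F} (ht₁ : Ideal.span {algebraMap (𝓞 F) (𝓞 L) t₁} = P₁ ^ 3)
    {t₂ : 𝓞 F} (ht₂ : Ideal.span {algebraMap (𝓞 F) (𝓞 L) t₂} = P₂ ^ 3)
    (hram : ∀ Q : Ideal (𝓞 L), Q.IsMaximal → Q.ramificationIdx (𝓞 F) ≠ 1 → Q = P₁ ∨ Q = P₂)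
    (I : Ideal (𝓞 L)) (hI : I ≠ ⊥) (hinv : σ • I = I) :
    ∃ (c : 𝓞 F) (a b : ℕ), a < 3 ∧ b < 3 ∧
      I = Ideal.span {algebraMap (𝓞 F) (𝓞 L) c} * P₁ ^ a * P₂ ^ b := by
  induction I using IsNoetherian.induction with
  | hgt I ih =>
    by_cases hI1 : I = ⊤
    · refine ⟨1, 0, 0, by norm_num, by norm_num, ?_⟩
      rw [hI1, map_one, Ideal.span_singleton_one, pow_zero, pow_zero, mul_one, mul_one]
    obtain ⟨Q, hQ, hIQ⟩ := Ideal.exists_le_maximal I hI1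
    by_cases h1 : Q = P₁
    · rw [h1] at hIQ
      obtain ⟨J, hIJ, hlt, hJ0, hJinv⟩ :=
        exists_eq_mul_of_le σ hI hP₁.ne_top (smul_eq_of_pow_three_eq_span σ hP₁ ht₁) hinv hIQ
      obtain ⟨c, a, b, ha, hb, hJ⟩ := ih J hlt hJ0 hJinv
      rcases Nat.lt_or_ge (a + 1) 3 with ha' | ha'
      · refine ⟨c, a + 1, b, ha', hb, ?_⟩
        rw [hIJ, hJ]
        ring
      · have ha2 : a = 2 := by omega
        refine ⟨c * t₁, 0, b, by norm_num, hb, ?_⟩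
        rw [hIJ, hJ, ha2, map_mul, ← Ideal.span_singleton_mul_span_singleton, ht₁]
        ring
    by_cases h2 : Q = P₂
    · rw [h2] at hIQ
      obtain ⟨J, hIJ, hlt, hJ0, hJinv⟩ :=
        exists_eq_mul_of_le σ hI hP₂.ne_top (smul_eq_of_pow_three_eq_span σ hP₂ ht₂) hinv hIQ
      obtain ⟨c, a, b, ha, hb, hJ⟩ := ih J hlt hJ0 hJinv
      rcases Nat.lt_or_ge (b + 1) 3 with hb' | hb'
      · refine ⟨c, a, b + 1, ha, hb', ?_⟩
        rw [hIJ, hJ]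
        ring
      · have hb2 : b = 2 := by omega
        refine ⟨c * t₂, a, 0, ha, by norm_num, ?_⟩
        rw [hIJ, hJ, hb2, map_mul, ← Ideal.span_singleton_mul_span_singleton, ht₂]
        ring
    -- `Q` is unramified: peel off the whole orbit `𝔮𝓞_L = (g)`
    have he : Q.ramificationIdx (𝓞 F) = 1 := by
      by_contra hne
      rcases hram Q hQ hne with h | h
      exacts [h1 h, h2 h]
    haveI := hPID
    obtain ⟨g, hg⟩ := (IsPrincipalIdealRing.principal (Q.under (𝓞 F))).principal
    have hM : (Q.under (𝓞 F)).map (algebraMap (𝓞 F) (𝓞 L)) =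
        Ideal.span {algebraMap (𝓞 F) (𝓞 L) g} := by
      rw [hg, Ideal.submodule_span_eq, Ideal.map_span, Set.image_singleton]
    have hle : I ≤ Ideal.span {algebraMap (𝓞 F) (𝓞 L) g} :=
      hM ▸ le_map_under_of_smul_eq σ hσ hI hQ he hinv hIQ
    have hMtop : Ideal.span {algebraMap (𝓞 F) (𝓞 L) g} ≠ ⊤ := by
      rw [← hM]
      exact fun h => hQ.ne_top (top_le_iff.mp (h ▸ Ideal.map_comap_le))
    obtain ⟨J, hIJ, hlt, hJ0, hJinv⟩ :=
      exists_eq_mul_of_le σ hI hMtop (smul_span_algebraMap σ g) hinv hle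
    obtain ⟨c, a, b, ha, hb, hJ⟩ := ih J hlt hJ0 hJinv
    refine ⟨g * c, a, b, ha, hb, ?_⟩
    rw [hIJ, hJ, map_mul, ← Ideal.span_singleton_mul_span_singleton]
    ring

/-- **Hilbert 90, integral form.**  A norm-one element `ε ∈ 𝓞_L` of a cyclic extension `L/F`
with generator `σ` is `σ(y)/y` for some `0 ≠ y ∈ 𝓞_L` (clear denominators with a rational
integer). [folklore] -/
theorem exists_smul_eq_mul_of_norm_eq_one [IsGalois F L] (σ : L ≃ₐ[F] L)
    (hσ : ∀ τ : L ≃ₐ[F] L, τ ∈ Subgroup.zpowers σ) {ε : 𝓞 L}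
    (hε : Algebra.norm F ((ε : L)) = 1) : ∃ y : 𝓞 L, y ≠ 0 ∧ σ • y = ε * y := by
  obtain ⟨y, hy0, hy⟩ := CyclicNormIndex.exists_eq_div_of_norm_eq_one hσ hε
  have hx : IsAlgebraic ℤ y := (IsFractionRing.isAlgebraic_iff ℤ ℚ L).mpr (.of_finite ℚ y)
  obtain ⟨m, r, hm, hmr⟩ := hx.exists_nsmul_eq (𝓞 L)
  refine ⟨r, ?_, ?_⟩
  · intro hr
    rw [hr, map_zero, smul_eq_zero] at hmr
    rcases hmr with h | h
    exacts [hm h, hy0 h]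
  · apply RingOfIntegers.ext
    change σ (algebraMap (𝓞 L) L r) = algebraMap (𝓞 L) L (ε * r)
    rw [map_mul, ← hmr, map_nsmul, ← RingOfIntegers.coe_eq_algebraMap, hy, nsmul_eq_mul,
      nsmul_eq_mul]
    field_simp

/-- If `(y) = (c) · P` with `y ≠ 0` in a Dedekind domain, then `P` is principal. [folklore] -/
theorem isPrincipal_of_span_singleton_eq_mul {R : Type*} [CommRing R] [IsDedekindDomain R]
    {y c : R} {P : Ideal R} (h : Ideal.span {y} = Ideal.span {c} * P) (hy : y ≠ 0) :
    Submodule.IsPrincipal P := by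
  have hc : c ≠ 0 := by
    rintro rfl
    apply hy
    simpa using h
  have hmem : y ∈ Ideal.span {c} := by
    have : y ∈ Ideal.span {y} := Ideal.mem_span_singleton_self y
    rw [h] at this
    exact Ideal.mul_le_right this
  obtain ⟨z, hz⟩ := Ideal.mem_span_singleton'.mp hmem
  refine ⟨z, ?_⟩
  rw [Ideal.submodule_span_eq]
  refine mul_left_cancel₀ (mt Ideal.span_singleton_eq_bot.mp hc) ?_
  rw [← h, Ideal.span_singleton_mul_span_singleton, mul_comm c z, hz]

/-- **Invariant ideals are principal** (the lead's stub, Chevalley's ambiguous-ideal count for a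
cyclic cubic `L/F` over a PID base with two ramified primes and nine inequivalent norm-one
units): every nonzero `σ`-invariant ideal of `𝓞_L` is principal. [folklore] -/
theorem stub_invariantIdealsPrincipal :
    ∀ (F L : Type) [Field F] [NumberField F] [Field L] [NumberField L] [Algebra F L]
      [IsGalois F L] (σ : L ≃ₐ[F] L), (∀ τ : L ≃ₐ[F] L, τ ∈ Subgroup.zpowers σ) →
      Module.finrank F L = 3 → IsPrincipalIdealRing (𝓞 F) →
      ∀ (P₁ P₂ : Ideal (𝓞 L)), P₁.IsMaximal → P₂.IsMaximal → P₁ ≠ P₂ →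
        (∃ t₁ : 𝓞 F, Ideal.span {algebraMap (𝓞 F) (𝓞 L) t₁} = P₁ ^ 3) →
        (∃ t₂ : 𝓞 F, Ideal.span {algebraMap (𝓞 F) (𝓞 L) t₂} = P₂ ^ 3) →
        (∀ (Q : Ideal (𝓞 L)), Q.IsMaximal →
          Q.ramificationIdx (𝓞 F) ≠ 1 → Q = P₁ ∨ Q = P₂) →
        (∃ ε : Fin 9 → (𝓞 L)ˣ,
          (∀ i, Algebra.norm F (((ε i : 𝓞 L) : L)) = 1) ∧
          ∀ i j, i ≠ j → ∀ η : (𝓞 L)ˣ,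
            (((ε i : 𝓞 L) : L)) * ((η : 𝓞 L) : L) ≠ (((ε j : 𝓞 L) : L)) * σ ((η : 𝓞 L) : L)) →
        ∀ I : Ideal (𝓞 L), I ≠ ⊥ → σ • I = I → Submodule.IsPrincipal I := by
  intro F L _ _ _ _ _ _ σ hσ _h3 hPID P₁ P₂ hP₁ hP₂ _hP12 ht₁ ht₂ hram hε I hI hinv
  obtain ⟨t₁, ht₁⟩ := ht₁
  obtain ⟨t₂, ht₂⟩ := ht₂
  obtain ⟨ε, hεN, hεind⟩ := hε
  have hstruct : ∀ J : Ideal (𝓞 L), J ≠ ⊥ → σ • J = J → ∃ (c : 𝓞 F) (a b : ℕ), a < 3 ∧ b < 3 ∧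
      J = Ideal.span {algebraMap (𝓞 F) (𝓞 L) c} * P₁ ^ a * P₂ ^ b := fun J hJ hJinv =>
    exists_eq_span_mul_pow σ hσ hPID hP₁ hP₂ ht₁ ht₂ hram J hJ hJinv
  -- it suffices that `P₁` and `P₂` are principal
  suffices hP : Submodule.IsPrincipal P₁ ∧ Submodule.IsPrincipal P₂ by
    obtain ⟨c, a, b, -, -, hIeq⟩ := hstruct I hI hinv
    obtain ⟨z₁, hz₁⟩ := hP.1.principal
    obtain ⟨z₂, hz₂⟩ := hP.2.principal
    rw [Ideal.submodule_span_eq] at hz₁ hz₂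
    rw [hIeq, hz₁, hz₂, Ideal.span_singleton_pow, Ideal.span_singleton_pow,
      Ideal.span_singleton_mul_span_singleton, Ideal.span_singleton_mul_span_singleton]
    infer_instance
  -- Hilbert 90: nine invariant principal ideals `(y i)`
  have hy : ∀ i, ∃ y : 𝓞 L, y ≠ 0 ∧ σ • y = (ε i : 𝓞 L) * y := fun i =>
    exists_smul_eq_mul_of_norm_eq_one σ hσ (hεN i)
  choose y hy0 hyσ using hy
  have hyinv : ∀ i, σ • Ideal.span {y i} = Ideal.span {y i} := by
    intro i
    rw [Ideal.smul_closure, Set.smul_set_singleton, hyσ]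
    exact Ideal.span_singleton_mul_left_unit (ε i).isUnit (y i)
  have hdec : ∀ i, ∃ (c : 𝓞 F) (a b : ℕ), a < 3 ∧ b < 3 ∧
      Ideal.span {y i} = Ideal.span {algebraMap (𝓞 F) (𝓞 L) c} * P₁ ^ a * P₂ ^ b := fun i =>
    hstruct _ (mt Ideal.span_singleton_eq_bot.mp (hy0 i)) (hyinv i)
  choose c a b ha hb hdec using hdec
  have hc0 : ∀ i, c i ≠ 0 := by
    intro i hci
    apply hy0 i
    have := hdec i
    rw [hci, map_zero] at this
    simpa using this
  -- the exponent pairs are pairwise distinct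
  have hinj : Function.Injective (fun i => ((⟨a i, ha i⟩ : Fin 3), (⟨b i, hb i⟩ : Fin 3))) := by
    intro i j hij
    simp only [Prod.mk.injEq, Fin.mk.injEq] at hij
    obtain ⟨haij, hbij⟩ := hij
    by_contra hne
    have key : Ideal.span {y i * algebraMap (𝓞 F) (𝓞 L) (c j)} =
        Ideal.span {y j * algebraMap (𝓞 F) (𝓞 L) (c i)} := by
      rw [← Ideal.span_singleton_mul_span_singleton, ← Ideal.span_singleton_mul_span_singleton,
        hdec i, hdec j, haij, hbij]
      ring
    obtain ⟨u, hu⟩ := Ideal.span_singleton_eq_span_singleton.mp key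
    -- pass to `L` and apply `σ`
    have hu' := congrArg (algebraMap (𝓞 L) L) hu
    rw [map_mul, map_mul, map_mul] at hu'
    have hσu := congrArg (fun x : 𝓞 L => algebraMap (𝓞 L) L (σ • x)) hu
    simp only [smul_mul', map_mul, hyσ, smul_algebraMap_ringOfIntegers] at hσu
    have hσu' : algebraMap (𝓞 L) L (σ • (u : 𝓞 L)) = σ (algebraMap (𝓞 L) L u) := rfl
    rw [hσu'] at hσu
    have h0 : algebraMap (𝓞 L) L (y i) * algebraMap (𝓞 L) L (algebraMap (𝓞 F) (𝓞 L) (c j)) ≠ 0 :=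
      mul_ne_zero (RingOfIntegers.coe_ne_zero_iff.mpr (hy0 i))
        (RingOfIntegers.coe_ne_zero_iff.mpr
          ((map_ne_zero_iff _ (RingOfIntegers.algebraMap.injective F L)).mpr (hc0 j)))
    have hfin : algebraMap (𝓞 L) L (y i) * algebraMap (𝓞 L) L (algebraMap (𝓞 F) (𝓞 L) (c j)) *
        (algebraMap (𝓞 L) L (ε i) * σ (algebraMap (𝓞 L) L u)) =
        algebraMap (𝓞 L) L (y i) * algebraMap (𝓞 L) L (algebraMap (𝓞 F) (𝓞 L) (c j)) *
        (algebraMap (𝓞 L) L (ε j) * algebraMap (𝓞 L) L u) := by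
      linear_combination hσu - algebraMap (𝓞 L) L (ε j) * hu'
    exact hεind j i (Ne.symm hne) u (mul_left_cancel₀ h0 hfin).symm
  -- hence every pair occurs; `(1,0)` and `(0,1)` make `P₁`, `P₂` principal
  have hsurj : Function.Surjective (fun i => ((⟨a i, ha i⟩ : Fin 3), (⟨b i, hb i⟩ : Fin 3))) :=
    ((Fintype.bijective_iff_injective_and_card _).mpr ⟨hinj, by simp⟩).2
  constructor
  · obtain ⟨i, hi⟩ := hsurj (1, 0)
    simp only [Prod.mk.injEq, Fin.ext_iff, Fin.val_one, Fin.val_zero] at hi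
    have h := hdec i
    rw [hi.1, hi.2, pow_one, pow_zero, mul_one] at h
    exact isPrincipal_of_span_singleton_eq_mul h (hy0 i)
  · obtain ⟨i, hi⟩ := hsurj (0, 1)
    simp only [Prod.mk.injEq, Fin.ext_iff, Fin.val_one, Fin.val_zero] at hi
    have h := hdec i
    rw [hi.1, hi.2, pow_one, pow_zero, mul_one] at h
    exact isPrincipal_of_span_singleton_eq_mul h (hy0 i)

end Summit.QuantumAdvantage.QuantumAdvantage.Theorems.LinnikCubicClassGroups

end
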